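import Literature.IUT.HodgeArakelov.MonoThetaProjectiveProp16EllipticRefChainProofs
import Literature.IUT.HodgeArakelov.MonoThetaProjectiveProp16EllipticRefIdentityWitness

/-!
# [IUTchII] Prop. 1.6 (ii): abc-iut-L6-t21's IDENTITY output (finding A21g10-F1, p447116) FAILS the strengthened
# successor predicate `RefIsEllipticChain` (proof-only sequel)

PROOF-ONLY (two theorems; no `def`, no instance, no named fact), abc-iut cell, seat abc-iut-L6-t2 (gen 3), row
«REFISELLIPTIC-R2-CHAIN» of abc-iut-L6-lead §F v1.19at-ter (1); DAG node **IUTchII:Prop1.6(ii)** (layer L6, outside the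
[IUTchIII] Cor. 3.12 cone). S. Mochizuki, *Inter-universal Teichmüller Theory II*, kurims manuscript (Dec. 2020), §1,
Prop. 1.6 (ii) p. 31 l. 34–41 [claim: Mochizuki2012, status: disputed] (IUTchII §1 Prop 1.6 (ii), kurims p.31);
[AbsTopII] Cor. 3.3 (iii)(a) p. 68 [cite: MochizukiAbsTopII2013, Cor 3.3 (iii)(a) p.68].

abc-iut-L6-t21's kernel witness `IdentityWitness.idOutput S N` (`U := X`, reference surjection `:= id`, no cusp removed)
satisfies abc-iut-w5-d030's v1 predicate `RefIsElliptic` (`refIsElliptic_idOutput_self`) and inhabits `Genuine`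
(`nonempty_genuine_self`) for EVERY `N`. Against the v2 predicate of `MonoThetaProjectiveProp16EllipticRefChain.lean`
(clause (R2′): the [AbsTopII] Cor. 3.3 (iii) record REALIZES the printed chain of `N² − 1` de-cuspidalizations) it FAILS
for every `N ≥ 2` — an instance of `RefIsEllipticChain.not_of_refHom_eq_self` / `not_of_completesToIso`
(`MonoThetaProjectiveProp16EllipticRefChainProofs.lean`; L4 input `RealizesChain.proj_not_injective_of_two_le`).
HONEST SCOPE: a statement about the tree's typing; no side on [IUTchIII] Cor. 3.12; typed ≠ proved.
-/

universe u

namespace Literature.IUT.HodgeArakelov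

open Literature.AnabelianGeometry.SemiGraphs (TemperedCurve)

namespace EllipticCuspidalization

namespace IdentityWitness

variable (S : ThetaSetting.{0}) (N : ℕ+) {p : ℕ} [Fact p.Prime] (X : TemperedCurve p) (eX : X.PiTemp ≃ₜ* S.PiX)

/-- **abc-iut-L6-t21's identity output FAILS the strengthened predicate** for every `N ≥ 2`, every tempered curve `X`
and identification `eX` — whatever extension, record, cuspidal data one offers for (R2′): its tempered reference
surjection is the identity of `Π^tp_X` (`refHom_idOutput_apply`), which completes to the identity of `Π̂_X`. (For v1,
by contrast, `refIsElliptic_idOutput_self` p447116.) [claim: Mochizuki2012, status: disputed] (IUTchII §1 Prop 1.6 (ii), kurims p.31) -/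
theorem not_refIsEllipticChain_idOutput (hN : 2 ≤ (N : ℕ)) :
    ¬ (idOutput S N).RefIsEllipticChain X X eX eX :=
  RefIsEllipticChain.not_of_completesToIso hN (ContinuousMulEquiv.refl X.PiHat) fun y => by
    rw [refHom_idOutput_apply]
    rfl

/-- Hence, for `N ≥ 2`, NO v2-genuine output `GenuineChain S N S.PiX X X eX` has BOTH the identity as underlying output
AND `eX` as its reference identification — the degenerate inhabitant of v1 (`nonempty_genuine_self`, p447116) is gone.
[claim: Mochizuki2012, status: disputed] (IUTchII §1 Prop 1.6 (ii), kurims p.31) -/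
theorem genuineChain_not_identity (hN : 2 ≤ (N : ℕ)) (G : EllipticCuspidalization.GenuineChain S N S.PiX X X eX)
    (hG : G.toEllipticCuspidalization = idOutput S N) : ¬ HEq G.eU eX := by
  intro heU
  cases G with
  | mk toGenuine hchain =>
    cases toGenuine with
    | mk K eU h₀ =>
      change K = idOutput S N at hG
      subst hG
      change HEq eU eX at heU
      have heU' : eU = eX := eq_of_heq heU
      subst heU'
      exact not_refIsEllipticChain_idOutput S N X eU hN hchain

end IdentityWitness

end EllipticCuspidalization

end Literature.IUT.HodgeArakelov
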